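import Mathlib
import HarnessLib
import Summits.HubbardSuperconductivity.HubbardSuperconductivity.Theorems.KLProgrammeKLRegimeEngineSliceTelScalars
import Summits.HubbardSuperconductivity.HubbardSuperconductivity.Theorems.KLProgrammeKLRegimeAlphaWtScalars2

/-!
# Route `KLProgramme` — crux K3 ENGINE (stmt-HubbardSuperconductivity-20437) stub (b) conj. 2 «(c-D)² FAMILY TELESCOPE», brick (D5s): the
# PER-STEP INCREMENT OF THE TELESCOPE IS `≤ 𝒦·U²·(M/β)/Λ` — pure scalar bookkeeping

Cell `gate-hubbard-kl`, seat hubbard-kl-k3c3-p2 (g11); F1-DESIGN §10.  The telescope (`rowSumWt_sliceCT_famBand_tel_le`) adds `Φ + Ψ` per step,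
`Φ = 8·(18·(D_w·(2·(√Ŵ·√N̄₂₄·(C₁G₀(5Λ_m)·c₀²(4c/Λ))))))`, `Ψ = 8·(9·(D_w x₀·(√Ŵ(x₀)·√N̄₂₄·A₀^♯(x₀))))`.  With `Ŵ` in product form
(`telW_le`, time rate `s₀ = σΛβ/M`), `Ŵ(x₀) ≤ x₀²Ŵ` (`telW_ref_le`), the fat support count in closed form (`fatSupport_closed`, `N = 2^{m+1}`,
`Λ₁ = 4^jΛ`), p3's `alphaProductWt_le`, the amplitude bound `A₀^♯(x₀) ≤ (G₀/x₀²)/(cΛ²)·𝒜` (`…CovAmpPack`), the weight constant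
`D_w ≤ Λ·D_c`, `Λ_m = 4^{j+1}Λ ≤ 1` and `G₀ ≤ g·U²`:

* **`famTel_increment_scalar_le`** — `Φ + Ψ ≤ 𝒦·U²·(M/β)/Λ`, `𝒦 = √(48·(1048576P_ρ/σ)·(128c₁c_ρ16^j/(π²γ)))·g·D_c·(288·20·d·e₀²/4^{j+1} + 72𝒜)`.

Pure real-arithmetic bookkeeping; no definitions, no sorry. [folklore]
-/

noncomputable section

namespace Summit.HubbardSuperconductivity.HubbardSuperconductivity.Theorems.TorusFourierL2

set_option linter.dupNamespace false -- summit = problem name (single-conjunct summit), D-0017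

open Real Literature.MathematicalPhysics.QuantumLattice Literature.MathematicalPhysics.QuantumLattice.BandSectorCounting

set_option maxHeartbeats 4000000 in
/-- **The per-step increment of the family telescope is `≤ 𝒦·U²·(M/β)/Λ`** (see the module docstring). [folklore] -/
theorem famTel_increment_scalar_le {a b : ℝ} (B : BandBounds a b) {A e₀ d Λ Λ₁ lam β L M N s₀ σ ρ ρ₃ x₀ Dw Dc G₀ g U ρf cρ c₁ Kp AΔs 𝒜 : ℝ}
    {m j : ℕ} (hA : 0 ≤ A) (hγ : 0 < 2 * B.rhomin - 4 * A) (hDt : 0 < B.Dtmin - 2 * A) (he : 0 < e₀) (hd : 0 ≤ d) (hΛ : 0 < Λ) (hΛ1 : Λ ≤ 1)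
    (hΛ₁ : Λ₁ = (4 : ℝ) ^ j * Λ) (hlam : lam = (4 : ℝ) ^ (j + 1) * Λ) (hβ : 0 < β) (hL : 0 < L) (hM : 0 < M) (hN2 : 2 ≤ N)
    (hπβ : π ≤ lam * β) (hNΛ : Λ₁ * N ^ 2 = e₀) (hw : sectorWidth (m + 1) = π / N)
    (hρfd : ρf = (lam + B.smax * B.Dtmin * (3 * sectorWidth (m + 1) / 4)) / (B.Dtmin - 2 * A) + π * Real.sqrt 2 * (1 + (4 + 2 * A) / (B.Dtmin - 2 * A)) * sectorWidth (m + 1))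
    (hcρ : cρ = (2 * e₀ / π + B.smax * B.Dtmin * (3 / 4)) / (B.Dtmin - 2 * A) + π * Real.sqrt 2 * (1 + (4 + 2 * A) / (B.Dtmin - 2 * A)))
    (hKp : Kp = 4 + 4 * A) (hc₁ : c₁ = 4 + Kp * cρ ^ 2 * π ^ 2 / e₀)
    (hLN : 2 * π * N * (N + 1 / 2) ≤ L) (hL1 : (2 * B.rhomin - 4 * A) * π ≤ 2 * Real.sqrt 2 * L * Λ₁)
    (hσ : 0 < σ) (hs₀ : s₀ = σ * Λ * β / M) (hs₀1 : σ * Λ * β ≤ M) (hρ : 0 < ρ) (hρ₃ : 0 < ρ₃) (hx₀ : 1 ≤ x₀)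
    (hDw0 : 0 ≤ Dw) (hDc : 0 ≤ Dc) (hDw : Dw ≤ Λ * Dc) (hG₀ : 0 ≤ G₀) (hg : 0 ≤ g) (hG₀U : G₀ ≤ g * U ^ 2) (hAΔ0 : 0 ≤ AΔs) (h𝒜 : 0 ≤ 𝒜)
    (hAΔ : AΔs ≤ (G₀ / x₀ ^ 2) / ((β * L ^ 2) * Λ ^ 2) * 𝒜) :
    8 * ((18 : ℕ) * (Dw * (2 * (Real.sqrt (524288 * (1 / s₀ + 1) * ((1 + 4 * Real.sqrt 2) ^ 2 * ((2 * Real.sqrt 2 / ρ + 2) * (2 * Real.sqrt 2 / ρ₃ + 2)) + (1 / ρ + 1) ^ 2)) *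
        Real.sqrt (24 * (2 * M) * L ^ 2 *
          ((lam * β / π + 1) *
            ((Real.sqrt 2 * L * ((lam + (4 + 4 * A) * ρf ^ 2) / (2 * B.rhomin - 4 * A)) / π + 2) *
              (Real.sqrt 2 * L * (2 * ρf) / π + 2)))) *
        (d * e₀ ^ 2 / lam ^ 2 * (G₀ * (5 * lam)) * ((1 / (β * L ^ 2)) ^ 2 * (4 * (β * L ^ 2) / Λ))))))) +
      8 * ((9 : ℕ) * (Dw * x₀ * (Real.sqrt (524288 * (1 / s₀ + 1) * ((1 + 4 * Real.sqrt 2) ^ 2 * ((2 * Real.sqrt 2 / (ρ / x₀) + 2) * (2 * Real.sqrt 2 / (ρ₃ / x₀) + 2)) + (1 / (ρ / x₀) + 1) ^ 2)) *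
        Real.sqrt (24 * (2 * M) * L ^ 2 *
          ((lam * β / π + 1) *
            ((Real.sqrt 2 * L * ((lam + (4 + 4 * A) * ρf ^ 2) / (2 * B.rhomin - 4 * A)) / π + 2) *
              (Real.sqrt 2 * L * (2 * ρf) / π + 2)))) * AΔs))) ≤
    (Real.sqrt (48 * (1048576 * ((1 + 4 * Real.sqrt 2) ^ 2 * ((2 * Real.sqrt 2 / ρ + 2) * (2 * Real.sqrt 2 / ρ₃ + 2)) + (1 / ρ + 1) ^ 2) / σ) *
        (128 * c₁ * cρ / (π ^ 2 * (2 * B.rhomin - 4 * A)) * (16 : ℝ) ^ j)) * g * Dc * (288 * (20 * (d * e₀ ^ 2)) / (4 : ℝ) ^ (j + 1) + 72 * 𝒜)) *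
      U ^ 2 * (M / β) / Λ := by
  have hπ := Real.pi_pos
  have hN : 0 < N := by linarith
  have hx₀0 : 0 < x₀ := lt_of_lt_of_le one_pos hx₀
  have hΛ₁0 : 0 < Λ₁ := by rw [hΛ₁]; positivity
  have hlam0 : 0 < lam := by rw [hlam]; positivity
  have hlam4 : lam = 4 * Λ₁ := by rw [hlam, hΛ₁, pow_succ]; ring
  have hs₀0 : 0 < s₀ := by rw [hs₀]; positivity
  have hc : 0 < β * L ^ 2 := by positivity
  -- names
  set Pρ : ℝ := (1 + 4 * Real.sqrt 2) ^ 2 * ((2 * Real.sqrt 2 / ρ + 2) * (2 * Real.sqrt 2 / ρ₃ + 2)) + (1 / ρ + 1) ^ 2 with hPρ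
  set W₀ : ℝ := 524288 * (1 / s₀ + 1) * Pρ with hW₀
  set Ns : ℝ := (lam * β / π + 1) * ((Real.sqrt 2 * L * ((lam + (4 + 4 * A) * ρf ^ 2) / (2 * B.rhomin - 4 * A)) / π + 2) * (Real.sqrt 2 * L * (2 * ρf) / π + 2))
    with hNs
  set CW : ℝ := 1048576 * Pρ * Λ / (σ * N) with hCW
  set CN : ℝ := 128 * c₁ * cρ / (π ^ 2 * (2 * B.rhomin - 4 * A)) * (16 : ℝ) ^ j with hCN
  set S : ℝ := Real.sqrt (48 * (1048576 * Pρ / σ) * (128 * c₁ * cρ / (π ^ 2 * (2 * B.rhomin - 4 * A)) * (16 : ℝ) ^ j)) with hS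
  have hPρ0 : 0 < Pρ := by positivity
  have hW₀0 : 0 ≤ W₀ := by positivity
  have hcρ0 : 0 ≤ cρ := by rw [hcρ]; have := B.smax_pos; have := B.Dtmin_pos; positivity
  have hc₁0 : 0 ≤ c₁ := by rw [hc₁, hKp]; positivity
  have hCW0 : 0 ≤ CW := by positivity
  have hCN0 : 0 ≤ CN := by positivity
  have hρf0 : 0 ≤ ρf := by rw [hρfd]; have := B.smax_pos; have := B.Dtmin_pos; have := sectorWidth_pos (m + 1); positivity
  have hNs0 : 0 ≤ Ns := by positivity
  -- `Ŵ` in product form and `N̄` in closed form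
  have hW : W₀ ≤ CW * (M / β) * N / Λ ^ 2 := telW_le hσ hΛ hβ hM hN hρ hρ₃ hs₀ hs₀1
  have hNsb : Ns ≤ CN * (β * L ^ 2 * Λ ^ 2 / N) := by
    have h := fatSupport_closed B hA hγ hDt he hΛ₁0 hβ hL hN2 hlam4 hπβ hNΛ hw hρfd hcρ hKp hc₁ hLN hL1
    refine h.trans (le_of_eq ?_)
    rw [hCN, hΛ₁, show (16 : ℝ) ^ j = ((4 : ℝ) ^ j) ^ 2 by rw [← pow_mul, mul_comm, pow_mul]; norm_num]; ring
  have hP := alphaProductWt_le hW₀0 hNs0 hCW0 hCN0 hM hβ hL hΛ hN hW hNsb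
  -- `√(48·C_W·C_N) ≤ S` (`Λ/N ≤ 1`)
  have hSS : Real.sqrt (48 * CW * CN) ≤ S := by
    apply Real.sqrt_le_sqrt
    have hCWle : CW ≤ 1048576 * Pρ / σ := by
      rw [hCW, div_le_div_iff₀ (by positivity) hσ]
      have : Λ * σ ≤ σ * N := by nlinarith [hΛ1, hN2, hσ, hΛ]
      nlinarith [this, hPρ0]
    have : 48 * CW * CN ≤ 48 * (1048576 * Pρ / σ) * CN := by gcongr
    simpa [hCN, mul_assoc] using this
  have hS0 : 0 ≤ S := Real.sqrt_nonneg _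
  have hprod : Real.sqrt W₀ * Real.sqrt (24 * (2 * M) * L ^ 2 * Ns) * ((1 / (β * L ^ 2)) ^ 2 * (4 * (β * L ^ 2) / Λ)) ≤ 4 * S * (M / β) / Λ :=
    hP.trans (by gcongr)
  have hprod0 : 0 ≤ Real.sqrt W₀ * Real.sqrt (24 * (2 * M) * L ^ 2 * Ns) := by positivity
  -- the family term
  have hΛlam : Λ / lam = 1 / (4 : ℝ) ^ (j + 1) := by rw [hlam]; field_simp
  have hΦ : 8 * ((18 : ℕ) * (Dw * (2 * (Real.sqrt W₀ * Real.sqrt (24 * (2 * M) * L ^ 2 * Ns) *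
        (d * e₀ ^ 2 / lam ^ 2 * (G₀ * (5 * lam)) * ((1 / (β * L ^ 2)) ^ 2 * (4 * (β * L ^ 2) / Λ))))))) ≤
      S * g * Dc * (288 * (20 * (d * e₀ ^ 2)) / (4 : ℝ) ^ (j + 1)) * U ^ 2 * (M / β) / Λ := by
    have e1 : 8 * ((18 : ℕ) * (Dw * (2 * (Real.sqrt W₀ * Real.sqrt (24 * (2 * M) * L ^ 2 * Ns) *
        (d * e₀ ^ 2 / lam ^ 2 * (G₀ * (5 * lam)) * ((1 / (β * L ^ 2)) ^ 2 * (4 * (β * L ^ 2) / Λ))))))) =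
        288 * (Dw * (5 * d * e₀ ^ 2 * G₀ / lam)) *
          (Real.sqrt W₀ * Real.sqrt (24 * (2 * M) * L ^ 2 * Ns) * ((1 / (β * L ^ 2)) ^ 2 * (4 * (β * L ^ 2) / Λ))) := by
      push_cast; field_simp; ring
    rw [e1]
    have hamp : Dw * (5 * d * e₀ ^ 2 * G₀ / lam) ≤ (Λ * Dc) * (5 * d * e₀ ^ 2 * (g * U ^ 2) / lam) := by
      apply mul_le_mul hDw _ (by positivity) (by positivity)
      exact div_le_div_of_nonneg_right (by nlinarith [hG₀U, hd, sq_nonneg e₀, mul_nonneg (mul_nonneg (by norm_num : (0:ℝ) ≤ 5) hd) (sq_nonneg e₀)]) hlam0.le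
    calc 288 * (Dw * (5 * d * e₀ ^ 2 * G₀ / lam)) * (Real.sqrt W₀ * Real.sqrt (24 * (2 * M) * L ^ 2 * Ns) * ((1 / (β * L ^ 2)) ^ 2 * (4 * (β * L ^ 2) / Λ)))
        ≤ 288 * ((Λ * Dc) * (5 * d * e₀ ^ 2 * (g * U ^ 2) / lam)) * (4 * S * (M / β) / Λ) :=
          mul_le_mul (mul_le_mul_of_nonneg_left hamp (by norm_num)) hprod (by positivity) (by positivity)
      _ = S * g * Dc * (288 * (20 * (d * e₀ ^ 2)) * (Λ / lam)) * U ^ 2 * (M / β) / Λ := by field_simp; ring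
      _ = _ := by rw [hΛlam]; ring
  -- the covariance term
  have hW' : Real.sqrt (524288 * (1 / s₀ + 1) * ((1 + 4 * Real.sqrt 2) ^ 2 * ((2 * Real.sqrt 2 / (ρ / x₀) + 2) * (2 * Real.sqrt 2 / (ρ₃ / x₀) + 2)) + (1 / (ρ / x₀) + 1) ^ 2)) ≤
      x₀ * Real.sqrt W₀ := by
    have h := telW_ref_le hs₀0 hx₀ hρ hρ₃
    calc _ ≤ Real.sqrt (x₀ ^ 2 * W₀) := Real.sqrt_le_sqrt h
      _ = x₀ * Real.sqrt W₀ := by rw [Real.sqrt_mul (by positivity), Real.sqrt_sq hx₀0.le]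
  have hΨ : 8 * ((9 : ℕ) * (Dw * x₀ * (Real.sqrt (524288 * (1 / s₀ + 1) * ((1 + 4 * Real.sqrt 2) ^ 2 * ((2 * Real.sqrt 2 / (ρ / x₀) + 2) * (2 * Real.sqrt 2 / (ρ₃ / x₀) + 2)) + (1 / (ρ / x₀) + 1) ^ 2)) *
        Real.sqrt (24 * (2 * M) * L ^ 2 * Ns) * AΔs))) ≤ S * g * Dc * (72 * 𝒜) * U ^ 2 * (M / β) / Λ := by
    have step1 : Real.sqrt (524288 * (1 / s₀ + 1) * ((1 + 4 * Real.sqrt 2) ^ 2 * ((2 * Real.sqrt 2 / (ρ / x₀) + 2) * (2 * Real.sqrt 2 / (ρ₃ / x₀) + 2)) + (1 / (ρ / x₀) + 1) ^ 2)) *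
        Real.sqrt (24 * (2 * M) * L ^ 2 * Ns) * AΔs ≤ (x₀ * Real.sqrt W₀) * Real.sqrt (24 * (2 * M) * L ^ 2 * Ns) * ((G₀ / x₀ ^ 2) / ((β * L ^ 2) * Λ ^ 2) * 𝒜) :=
      mul_le_mul (mul_le_mul_of_nonneg_right hW' (Real.sqrt_nonneg _)) hAΔ hAΔ0 (by positivity)
    have e2 : (x₀ * Real.sqrt W₀) * Real.sqrt (24 * (2 * M) * L ^ 2 * Ns) * ((G₀ / x₀ ^ 2) / ((β * L ^ 2) * Λ ^ 2) * 𝒜) =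
        (Real.sqrt W₀ * Real.sqrt (24 * (2 * M) * L ^ 2 * Ns) * ((1 / (β * L ^ 2)) ^ 2 * (4 * (β * L ^ 2) / Λ))) * (G₀ * 𝒜 / (4 * x₀ * Λ)) := by
      field_simp
    have step2 : (Real.sqrt W₀ * Real.sqrt (24 * (2 * M) * L ^ 2 * Ns) * ((1 / (β * L ^ 2)) ^ 2 * (4 * (β * L ^ 2) / Λ))) * (G₀ * 𝒜 / (4 * x₀ * Λ)) ≤
        (4 * S * (M / β) / Λ) * (G₀ * 𝒜 / (4 * x₀ * Λ)) := mul_le_mul_of_nonneg_right hprod (by positivity)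
    have e3 : 8 * ((9 : ℕ) * (Dw * x₀ * ((4 * S * (M / β) / Λ) * (G₀ * 𝒜 / (4 * x₀ * Λ))))) = 72 * (Dw * G₀ / Λ) * (S * 𝒜) * (M / β) / Λ := by
      push_cast; field_simp; ring
    have hDG : Dw * G₀ / Λ ≤ Dc * (g * U ^ 2) := by
      rw [div_le_iff₀ hΛ]
      calc Dw * G₀ ≤ (Λ * Dc) * (g * U ^ 2) := mul_le_mul hDw hG₀U hG₀ (by positivity)
        _ = Dc * (g * U ^ 2) * Λ := by ring
    calc _ ≤ 8 * ((9 : ℕ) * (Dw * x₀ * ((4 * S * (M / β) / Λ) * (G₀ * 𝒜 / (4 * x₀ * Λ))))) :=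
          mul_le_mul_of_nonneg_left (mul_le_mul_of_nonneg_left (mul_le_mul_of_nonneg_left (step1.trans (e2.le.trans step2)) (by positivity))
            (by positivity)) (by norm_num)
      _ = 72 * (Dw * G₀ / Λ) * (S * 𝒜) * (M / β) / Λ := e3
      _ ≤ 72 * (Dc * (g * U ^ 2)) * (S * 𝒜) * (M / β) / Λ := by gcongr
      _ = _ := by ring
  calc _ ≤ S * g * Dc * (288 * (20 * (d * e₀ ^ 2)) / (4 : ℝ) ^ (j + 1)) * U ^ 2 * (M / β) / Λ + S * g * Dc * (72 * 𝒜) * U ^ 2 * (M / β) / Λ := add_le_add hΦ hΨ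
    _ = _ := by rw [hS]; ring

set_option maxHeartbeats 4000000 in
/-- **The per-step increment bound without the sign hypothesis on `A₀^♯`** (if `A₀^♯ < 0` the covariance term is nonpositive and the case
`A₀^♯ := 0` of `famTel_increment_scalar_le` applies). [folklore] -/
theorem famTel_increment_scalar_le' {a b : ℝ} (B : BandBounds a b) {A e₀ d Λ Λ₁ lam β L M N s₀ σ ρ ρ₃ x₀ Dw Dc G₀ g U ρf cρ c₁ Kp AΔs 𝒜 : ℝ}
    {m j : ℕ} (hA : 0 ≤ A) (hγ : 0 < 2 * B.rhomin - 4 * A) (hDt : 0 < B.Dtmin - 2 * A) (he : 0 < e₀) (hd : 0 ≤ d) (hΛ : 0 < Λ) (hΛ1 : Λ ≤ 1)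
    (hΛ₁ : Λ₁ = (4 : ℝ) ^ j * Λ) (hlam : lam = (4 : ℝ) ^ (j + 1) * Λ) (hβ : 0 < β) (hL : 0 < L) (hM : 0 < M) (hN2 : 2 ≤ N)
    (hπβ : π ≤ lam * β) (hNΛ : Λ₁ * N ^ 2 = e₀) (hw : sectorWidth (m + 1) = π / N)
    (hρfd : ρf = (lam + B.smax * B.Dtmin * (3 * sectorWidth (m + 1) / 4)) / (B.Dtmin - 2 * A) + π * Real.sqrt 2 * (1 + (4 + 2 * A) / (B.Dtmin - 2 * A)) * sectorWidth (m + 1))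
    (hcρ : cρ = (2 * e₀ / π + B.smax * B.Dtmin * (3 / 4)) / (B.Dtmin - 2 * A) + π * Real.sqrt 2 * (1 + (4 + 2 * A) / (B.Dtmin - 2 * A)))
    (hKp : Kp = 4 + 4 * A) (hc₁ : c₁ = 4 + Kp * cρ ^ 2 * π ^ 2 / e₀)
    (hLN : 2 * π * N * (N + 1 / 2) ≤ L) (hL1 : (2 * B.rhomin - 4 * A) * π ≤ 2 * Real.sqrt 2 * L * Λ₁)
    (hσ : 0 < σ) (hs₀ : s₀ = σ * Λ * β / M) (hs₀1 : σ * Λ * β ≤ M) (hρ : 0 < ρ) (hρ₃ : 0 < ρ₃) (hx₀ : 1 ≤ x₀)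
    (hDw0 : 0 ≤ Dw) (hDc : 0 ≤ Dc) (hDw : Dw ≤ Λ * Dc) (hG₀ : 0 ≤ G₀) (hg : 0 ≤ g) (hG₀U : G₀ ≤ g * U ^ 2) (h𝒜 : 0 ≤ 𝒜)
    (hAΔ : AΔs ≤ (G₀ / x₀ ^ 2) / ((β * L ^ 2) * Λ ^ 2) * 𝒜) :
    8 * ((18 : ℕ) * (Dw * (2 * (Real.sqrt (524288 * (1 / s₀ + 1) * ((1 + 4 * Real.sqrt 2) ^ 2 * ((2 * Real.sqrt 2 / ρ + 2) * (2 * Real.sqrt 2 / ρ₃ + 2)) + (1 / ρ + 1) ^ 2)) *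
        Real.sqrt (24 * (2 * M) * L ^ 2 *
          ((lam * β / π + 1) *
            ((Real.sqrt 2 * L * ((lam + (4 + 4 * A) * ρf ^ 2) / (2 * B.rhomin - 4 * A)) / π + 2) *
              (Real.sqrt 2 * L * (2 * ρf) / π + 2)))) *
        (d * e₀ ^ 2 / lam ^ 2 * (G₀ * (5 * lam)) * ((1 / (β * L ^ 2)) ^ 2 * (4 * (β * L ^ 2) / Λ))))))) +
      8 * ((9 : ℕ) * (Dw * x₀ * (Real.sqrt (524288 * (1 / s₀ + 1) * ((1 + 4 * Real.sqrt 2) ^ 2 * ((2 * Real.sqrt 2 / (ρ / x₀) + 2) * (2 * Real.sqrt 2 / (ρ₃ / x₀) + 2)) + (1 / (ρ / x₀) + 1) ^ 2)) *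
        Real.sqrt (24 * (2 * M) * L ^ 2 *
          ((lam * β / π + 1) *
            ((Real.sqrt 2 * L * ((lam + (4 + 4 * A) * ρf ^ 2) / (2 * B.rhomin - 4 * A)) / π + 2) *
              (Real.sqrt 2 * L * (2 * ρf) / π + 2)))) * AΔs))) ≤
    (Real.sqrt (48 * (1048576 * ((1 + 4 * Real.sqrt 2) ^ 2 * ((2 * Real.sqrt 2 / ρ + 2) * (2 * Real.sqrt 2 / ρ₃ + 2)) + (1 / ρ + 1) ^ 2) / σ) *
        (128 * c₁ * cρ / (π ^ 2 * (2 * B.rhomin - 4 * A)) * (16 : ℝ) ^ j)) * g * Dc * (288 * (20 * (d * e₀ ^ 2)) / (4 : ℝ) ^ (j + 1) + 72 * 𝒜)) *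
      U ^ 2 * (M / β) / Λ := by
  rcases le_or_gt 0 AΔs with h0 | hneg
  · exact famTel_increment_scalar_le B hA hγ hDt he hd hΛ hΛ1 hΛ₁ hlam hβ hL hM hN2 hπβ hNΛ hw hρfd hcρ hKp hc₁ hLN hL1 hσ hs₀ hs₀1 hρ hρ₃ hx₀ hDw0 hDc hDw hG₀
      hg hG₀U h0 h𝒜 hAΔ
  · -- the covariance term is nonpositive: compare with the case `A₀^♯ := 0`
    have hx₀0 : 0 < x₀ := lt_of_lt_of_le one_pos hx₀
    have hb0 : (0 : ℝ) ≤ (G₀ / x₀ ^ 2) / ((β * L ^ 2) * Λ ^ 2) * 𝒜 := by positivity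
    have h1 := famTel_increment_scalar_le (AΔs := 0) B hA hγ hDt he hd hΛ hΛ1 hΛ₁ hlam hβ hL hM hN2 hπβ hNΛ hw hρfd hcρ hKp hc₁ hLN hL1 hσ hs₀ hs₀1 hρ hρ₃
      hx₀ hDw0 hDc hDw hG₀ hg hG₀U le_rfl h𝒜 hb0
    simp only [mul_zero, add_zero] at h1
    have hneg' : 8 * ((9 : ℕ) * (Dw * x₀ * (Real.sqrt (524288 * (1 / s₀ + 1) * ((1 + 4 * Real.sqrt 2) ^ 2 * ((2 * Real.sqrt 2 / (ρ / x₀) + 2) * (2 * Real.sqrt 2 / (ρ₃ / x₀) + 2)) + (1 / (ρ / x₀) + 1) ^ 2)) *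
        Real.sqrt (24 * (2 * M) * L ^ 2 *
          ((lam * β / π + 1) *
            ((Real.sqrt 2 * L * ((lam + (4 + 4 * A) * ρf ^ 2) / (2 * B.rhomin - 4 * A)) / π + 2) *
              (Real.sqrt 2 * L * (2 * ρf) / π + 2)))) * AΔs))) ≤ 0 := by
      have hnn : 0 ≤ 8 * ((9 : ℕ) * (Dw * x₀ * (Real.sqrt (524288 * (1 / s₀ + 1) * ((1 + 4 * Real.sqrt 2) ^ 2 * ((2 * Real.sqrt 2 / (ρ / x₀) + 2) * (2 * Real.sqrt 2 / (ρ₃ / x₀) + 2)) + (1 / (ρ / x₀) + 1) ^ 2)) *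
        Real.sqrt (24 * (2 * M) * L ^ 2 *
          ((lam * β / π + 1) *
            ((Real.sqrt 2 * L * ((lam + (4 + 4 * A) * ρf ^ 2) / (2 * B.rhomin - 4 * A)) / π + 2) *
              (Real.sqrt 2 * L * (2 * ρf) / π + 2))))))) := by positivity
      have e : ∀ (P Q : ℝ), 8 * ((9 : ℕ) * (Dw * x₀ * (P * Q * AΔs))) = (8 * ((9 : ℕ) * (Dw * x₀ * (P * Q)))) * AΔs := fun P Q => by ring
      rw [e]
      exact mul_nonpos_of_nonneg_of_nonpos hnn hneg.le
    linarith [h1, hneg']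

end Summit.HubbardSuperconductivity.HubbardSuperconductivity.Theorems.TorusFourierL2

end
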